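import Summits.FinalStateConjecture.FinalStateConjecture.Theses.HorizonTypeCascade

/-!
# Crux `GenericStationarySettling` — line `birth`: BIRTH SKELETON (BC3; skeleton registrar, 2026-08-17)

Crux item `stmt-FinalStateConjecture-18555`, decl (FIXED, concluded BY NAME in
`GenericStationarySettling_of` / `GenericStationarySettling_proof`):
`Summit.FinalStateConjecture.FinalStateConjecture.Theses.HorizonTypeCascade.GenericStationarySettling`
(route `route-FinalStateConjecture-HorizonTypeCascade`, crux rank 2 — the route's dynamical front
end "D"): for every data manifold `X`, tame-Christodoulou-generically in the admissible class, the
datum has an MGHD and every MGHD has complete `𝓘⁺` and SETTLES TO STATIONARY HOLES — an honest `C²`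
`StationaryFinalStateDecomposition` of `O = J⁺(ιX) ∩ I⁻(charted)` whose holes are `I⁺`-regular vacuum
black holes with `𝓔⁺ ≠ ∅`, every horizon component carrying a non-degenerate Killing COLLAR, adapted
charts immersive and horizon-penetrating, `RaysStayInClosure`, exhaustive charts with radii `→ ∞`,
future-oriented chart times (no Kerr, no connectedness asked of the dynamics).

## The cut — CENSORSHIP ⊕ THIRD LAW (generic) / SETTLING (pointwise) / MGHD EXISTENCE (pointwise)

This is the route header's own Two-layer plan for D ("GenericStationarySettling ⇐ SettlesIfCensored →
GenericCensorshipThirdLaw → D"; the opener's BC3 file is attached to the item as evidence but is not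
readable from a registrar seat, so the cut is re-typed here from the header), i.e. Dafermos–Luk's
reading of the final state problem as [weak cosmic censorship, generic] + [large-data asymptotic
settling] (arXiv:1710.01722 §1.2.1, p. 8), with Christodoulou's genericity (CQG 16 (1999) p. A24)
carried by ONE stub because tame genericity is monotone in the property but NOT closed under `∧`:

* `stub_genericCensorshipThirdLaw` — GENERIC: for every `X`, tame-Christodoulou-generically in the
  admissible class, every MGHD has complete future null infinity AND every HONEST `C⁰` Kerr final-state
  portrait of it (`FinalStateDecomposition … O 0` with `O = exteriorOf`, `RaysStayInClosure`,
  `HasExhaustiveCharts`, `IsFutureOriented`) has only SUB-extremal holes. Weak cosmic censorship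
  conjoined, on the same exceptional set, with "extremal black holes do not form generically" (third
  law as genericity). BY DESIGN THE VERBATIM SIGNATURE OF THE EXISTING ITEM stmt-FinalStateConjecture-17297
  (`GenericCensorshipThirdLaw` of routes GlobalAttraction (rank 3) / TwoBoundarySqueeze (rank 4)), so
  the generic half of D is the fleet's shared censorship crux, not a private copy. [open-problem; XL]
* `stub_settlesIfCensored` — POINTWISE (every admissible datum, NO genericity): every MGHD with
  complete `𝓘⁺` whose honest `C⁰` Kerr portraits are all sub-extremal carries the crux's stationary
  settled structure VERBATIM (the `∃ O d, …` clause of D). Large-data asymptotic stationarity of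
  censored, off-threshold vacuum developments: formation/ringdown to SOME stationary `I⁺`-regular vacuum
  configuration with non-degenerate collars, recession, exhaustion — the settling black box isolated
  from censorship and from the third law. [open-problem; XL; the HARDEST stub]
* `stub_mghdExists` — POINTWISE: every admissible datum has a maximal vacuum Cauchy development
  (Choquet-Bruhat–Geroch 1969 Thm 3; in tree the named fact `choquetBruhat_geroch_exists_mghd_cauchy`
  gives it by `choquetBruhat_geroch_exists_mghd_cauchy.forall_mem_admissibleVacuumData`). VERBATIM THE
  SIGNATURE OF THE EXISTING ITEM stmt-FinalStateConjecture-9937 (`MGHDExists` / `AdmissibleMGHDExists`,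
  support of TwoBoundarySqueeze, ProbeNullTrace, …). Known in print, unproved in tree. [XL formalisation]

Composition `GenericStationarySettling_of` (kernel-checked, no `sorry` of its own): monotonicity of
tame Christodoulou genericity in the property (inlined; it is `IsTameChristodoulouGeneric.mono` of
`Literature/Geometry/Lorentzian/TameGenericityDiagonal.lean`, kept out of the import cone as in the
route's `closes`) applied to Stub A's generic property, with the pointwise upgrade
`P_A D → P_D D` on the admissible class assembled from Stub B (the `∃ MGHD` conjunct) and Stub C (the
settled clause, fed Stub A's two conjuncts). The conclusion is the route decl BY NAME.

Logical position. Stub A is implied by neither D nor the summit cheaply (D's portraits are stationary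
`C²`, A constrains Kerr `C⁰` portraits; relating two portraits of one MGHD is uniqueness-of-limits
theory) and implies neither (no settling). Stub C is implied by neither (it is pointwise on ALL censored
off-threshold data, D and the summit are generic) and gives D only through A and B. Stub B is the
anti-vacuity conjunct, known in print. D ⇒ generic censorship (`genericCensorship_of_crux`, §4,
sorry-free) shows A's first conjunct is NECESSARY for D. No stub alone is the crux or the summit (BC3
probes, `Lines/birth.md`).

## Registrar's flags (recorded, not acted on — the crux is FIXED for this seat)

1. refuter-rattack-stmt-FinalStateConjecture-18555-0 (ATTACK.md §3, 2026-08-17) and the KerrChartTransfer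
   birth attack (`Cruxes/KerrChartTransfer/BirthAttack.md` §4) flag D `suspect-misstated`: for `N ≥ 1`
   the clause `horizon ⊆ range (adapted i)` (penetrating `T`-adapted charts with time-invariant open
   domains) puts an interior collar into `O` and into the adapted slabs, and the exhaustion clause
   `∀ τ₁ > τ₀` then forces PLUNGING adapted slabs (true in exact Kerr only with `inf f = −∞`), where the
   `C²` clause stops meaning "close to the model". Stub C inherits this clause VERBATIM in its
   conclusion (it must: the composition concludes D by name); if tenure re-types D along the recorded
   repairs R1/R3 (exterior-only charted sets / exhaust only `O ∩ I⁻(radiation zone)`), Stub C's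
   conclusion is re-typed identically and `GenericStationarySettling_of` is unchanged in shape.
2. Grounder flag (g79-0): the collar's tangency clause quantifies GLOBAL integral curves
   (`IsMIntegralCurve`) while vendored collar facts use local ones; fleet-wide dress, inherited by Stub C.

## Disproof used
None exists for this crux (`ledger crux ls stmt-FinalStateConjecture-18555`: no workfiles before this
one; no `Disproof.lean`, no `Theorems/GenericStationarySettling/Negative/`). `ledger negatives --problem
FinalStateConjecture` (2026-08-17): one unrelated entry (`not_UniformPhotonSphereChannels`, a
Regge–Wheeler channel estimate); no stub is an instance. The landed negative
`Theorems/GenericCensorshipCollarMargin/Negative/…FalseOfExtremalJunkCollars.lean` concerns UNWINDOWED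
Kerr–Schild collar-chart labels of route BartnikGapSettling — a different collar notion; Stub A's
third-law clause is windowed by honesty (`HasExhaustiveCharts`, `O = exteriorOf`) exactly as item 17297,
which that lemma does not touch.
-/

noncomputable section

-- D-0017: single-problem summit, `Summit.<S>.<S>.…` by design (cf. lakefile `weak.linter.dupNamespace`).
set_option linter.dupNamespace false

namespace Summit.FinalStateConjecture.FinalStateConjecture.Cruxes.GenericStationarySettling.Birth

open Set Filter Function Topology TopologicalSpace
open scoped Manifold ContDiff Classical
open Summit.FinalStateConjecture.FinalStateConjecture.Theses.HorizonTypeCascade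

/-! ## §1 The three statements of the line (named; nothing here is a route item of THIS route) -/

/-- **SETTLES IF CENSORED, pointwise** (`stub_settlesIfCensored`): for every connected Hausdorff
second-countable `3`-manifold `X`, every admissible datum `D` (NO genericity) and every maximal vacuum
Cauchy development `𝒟` of `D` with complete future null infinity all of whose HONEST `C⁰` Kerr
final-state portraits are sub-extremal, `𝒟` settles to stationary holes in the sense of the crux:
verbatim D's clause — a region `O` and a `C²` `StationaryFinalStateDecomposition d` of `O` with
`I⁺`-regular vacuum holes, `𝓔⁺ ≠ ∅`, a non-degenerate Killing collar on every horizon component,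
immersive horizon-penetrating adapted charts, `O = J⁺(ιX) ∩ I⁻(d.charted)`, `RaysStayInClosure`,
exhaustive charts with radii `→ ∞`, future-oriented chart times. Why it might fail: large-data
asymptotic stationarity is open even conditionally on censorship (an eternally radiating censored
development with no stationary ω-limit, or one settling to a smooth NON-Kerr hole with a DEGENERATE
component — for which the Kerr-dressed third-law hypothesis is vacuous — refutes it); and it inherits
D's flagged penetration/exhaustion tension (module docstring, flag 1).
[cite: DafermosLuk2017, §1.2.1 (p. 8)] [cite: Christodoulou1999, p. A24] [cite: ChruscielCosta2008, Def. 1.1] -/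
def SettlesIfCensored : Prop :=
  ∀ (X : Type) [TopologicalSpace X] [ChartedSpace Literature.Geometry.Lorentzian.E3 X] [IsManifold (𝓡 3) ((⊤ : ℕ∞) : WithTop ℕ∞) X] [T2Space X] [SecondCountableTopology X] [ConnectedSpace X], ∀ D ∈ Literature.Geometry.Lorentzian.admissibleVacuumData X, ∀ 𝒟 : Literature.Geometry.Lorentzian.VacuumCauchyDevelopment D, 𝒟.IsMaximal → Summit.FinalStateConjecture.HasCompleteNullInfinity 𝒟.toCauchyDevelopment → (∀ (O : Set 𝒟.carrier) (d : Literature.Geometry.Lorentzian.FinalStateDecomposition 𝒟.toSpacetime O 0), O = Summit.FinalStateConjecture.exteriorOf 𝒟.toCauchyDevelopment d.charted → Summit.FinalStateConjecture.RaysStayInClosure 𝒟.toCauchyDevelopment O → Summit.FinalStateConjecture.HasExhaustiveCharts d → Summit.FinalStateConjecture.IsFutureOriented d → ∀ i, Literature.Geometry.Lorentzian.Kerr.IsSubextremal (d.mass i) (d.spin i)) → ∃ (O : Set 𝒟.carrier) (d : Literature.Geometry.Lorentzian.StationaryFinalStateDecomposition 𝒟.toSpacetime O 2), (∀ i, (∀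 [(d.hole i).metric.HasLeviCivita], (d.hole i).IsIPlusRegular ∧ (d.hole i).metric.toPseudoRiemannianMetric.IsRicciFlat ∧ (d.hole i).horizon.Nonempty ∧ (∀ p ∈ (d.hole i).horizon, ∃ (U : Set (d.hole i).carrier) (K : Π x : (d.hole i).carrier, TangentSpace (𝓡 4) x) (κ : ℝ), IsOpen U ∧ connectedComponentIn (d.hole i).horizon p ⊆ U ∧ ContMDiffOn (𝓡 4) ((𝓡 4).prod 𝓘(ℝ, Literature.Geometry.Lorentzian.E4)) ((⊤ : ℕ∞) : WithTop ℕ∞) (fun x ↦ (Bundle.TotalSpace.mk' Literature.Geometry.Lorentzian.E4 x (K x) : TangentBundle (𝓡 4) (d.hole i).carrier)) U ∧ (∀ x ∈ U, ∀ v w : TangentSpace (𝓡 4) x, (d.hole i).metric.val x ((d.hole i).metric.leviCivita K x v) w + (d.hole i).metric.val x v ((d.hole i).metric.leviCivita K x w) = 0) ∧ (∀ x ∈ U, VectorField.mlieBracket (𝓡 4) (d.hole i).killing K x = 0) ∧ (∀ q ∈ connectedComponentIn (d.hole i).horizon p, K q ≠ 0) ∧ (∀ γ : ℝ → (d.hole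 i).carrier, IsMIntegralCurve γ K → γ 0 ∈ connectedComponentIn (d.hole i).horizon p → ∀ t, γ t ∈ (d.hole i).horizon) ∧ κ ≠ 0 ∧ ∀ q ∈ connectedComponentIn (d.hole i).horizon p, (d.hole i).metric.leviCivita K q (K q) = κ • K q))) ∧ (∀ i, (∀ x, Function.Injective (mfderiv 𝓘(ℝ, Literature.Geometry.Lorentzian.E4) (𝓡 4) (d.adapted i).toFun x)) ∧ (d.hole i).horizon ⊆ Set.range (d.adapted i).toFun) ∧ O = Summit.FinalStateConjecture.exteriorOf 𝒟.toCauchyDevelopment d.charted ∧ Summit.FinalStateConjecture.RaysStayInClosure 𝒟.toCauchyDevelopment O ∧ (∃ R : Fin d.N → ℝ → ℝ, (∀ i, Filter.Tendsto (R i) Filter.atTop Filter.atTop) ∧ (∀ i, Filter.Tendsto (fun τ ↦ 𝒟.toSpacetime.truncDeviationCk (d.background i) (d.toOver.chart i) 2 (R i τ) τ) Filter.atTop (nhds 0)) ∧ ∀ τ₁ : ℝ, d.toOver.τ₀ < τ₁ → O \ d.toOver.certifiedLate R τ₁ ⊆ 𝒟.toSpacetime.metric.causalPast 𝒟.toSpacetime.timeOrientation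 (d.toOver.certifiedSlab R τ₁)) ∧ ((∀ i, Summit.FinalStateConjecture.IsOrthochronous (d.motion i).1) ∧ (∀ i (ρ : ℝ), ∀ᶠ τ in Filter.atTop, ∀ x ∈ (d.background i).truncTimeSlab ρ τ, ∀ v : Literature.Geometry.Lorentzian.E4, mfderiv 𝓘(ℝ, Literature.Geometry.Lorentzian.E4) (𝓡 4) (d.adapted i).toFun ⟨Literature.Geometry.Lorentzian.poincareInv (d.motion i).1 (d.motion i).2 x.1, x.2⟩ v = (d.hole i).timeOrientation.vectorField ((d.adapted i).toFun ⟨Literature.Geometry.Lorentzian.poincareInv (d.motion i).1 (d.motion i).2 x.1, x.2⟩) → 𝒟.toSpacetime.timeOrientation.IsFutureDirected (mfderiv 𝓘(ℝ, Literature.Geometry.Lorentzian.E4) (𝓡 4) (d.toOver.chart i) x (((d.motion i).1 : Literature.Geometry.Lorentzian.E4 ≃L[ℝ] Literature.Geometry.Lorentzian.E4) v))) ∧ ∀ᶠ τ in Filter.atTop, ∀ x ∈ (Literature.Geometry.Lorentzian.Minkowski.backgroundOn d.toOver.flatDomain).timeSlab τ, 𝒟.toSpacetime.timeOrientation.IsFutureDirected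 (mfderiv 𝓘(ℝ, Literature.Geometry.Lorentzian.E4) (𝓡 4) d.toOver.flatChart x (Literature.Geometry.Lorentzian.E4.basisVector 0)))

/-- **GENERIC CENSORSHIP ⊕ THIRD LAW** (`stub_genericCensorshipThirdLaw`) — verbatim the signature of
item stmt-FinalStateConjecture-17297 (`GenericCensorshipThirdLaw` of routes GlobalAttraction /
TwoBoundarySqueeze): for every `X`, tame-Christodoulou-generically in the admissible class (codimension
`1`, witness curves on ONE fixed end), every MGHD has complete future null infinity and every honest
`C⁰` Kerr final-state portrait of it has only sub-extremal holes. Why it might fail: weak cosmic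
censorship is open in vacuum (naked singularities exist, arXiv:1912.08478) and the third-law clause
dies if extremal Kerr forms from an OPEN set of admissible data (threshold extremality,
arXiv:2402.10190); both must fail off one tame curve.
[cite: Christodoulou1999, p. A24] [cite: DafermosLuk2017, §1.2.1 (p. 8)] [cite: KehleUnger2025] -/
def GenericCensorshipThirdLaw : Prop :=
  ∀ (X : Type) [TopologicalSpace X] [ChartedSpace Literature.Geometry.Lorentzian.E3 X] [IsManifold (𝓡 3) ((⊤ : ℕ∞) : WithTop ℕ∞) X] [T2Space X] [SecondCountableTopology X] [ConnectedSpace X], Literature.Geometry.Lorentzian.InitialDataSet.IsTameChristodoulouGeneric (Literature.Geometry.Lorentzian.admissibleVacuumData X) (fun D ↦ ∀ 𝒟 : Literature.Geometry.Lorentzian.VacuumCauchyDevelopment D, 𝒟.IsMaximal → Summit.FinalStateConjecture.HasCompleteNullInfinity 𝒟.toCauchyDevelopment ∧ ∀ (O : Set 𝒟.carrier) (d : Literature.Geometry.Lorentzian.FinalStateDecomposition 𝒟.toSpacetime O 0), O = Summit.FinalStateConjecture.exteriorOf 𝒟.toCauchyDevelopment d.charted → Summit.FinalStateConjecture.RaysStayInClosure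 𝒟.toCauchyDevelopment O → Summit.FinalStateConjecture.HasExhaustiveCharts d → Summit.FinalStateConjecture.IsFutureOriented d → ∀ i, Literature.Geometry.Lorentzian.Kerr.IsSubextremal (d.mass i) (d.spin i)) 1

/-- **MGHD EXISTENCE on the admissible class** (`stub_mghdExists`) — verbatim the signature of item
stmt-FinalStateConjecture-9937 (`MGHDExists` / `AdmissibleMGHDExists`): every admissible datum has a
maximal vacuum Cauchy development. Choquet-Bruhat–Geroch 1969, Thm 3 (p. 332); in tree from the named
fact `choquetBruhat_geroch_exists_mghd_cauchy` by `….forall_mem_admissibleVacuumData`.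
[cite: ChoquetBruhatGeroch1969CMP, Thm. 3 (p. 332)] -/
def MGHDExists : Prop :=
  ∀ (X : Type) [TopologicalSpace X] [ChartedSpace Literature.Geometry.Lorentzian.E3 X] [IsManifold (𝓡 3) ((⊤ : ℕ∞) : WithTop ℕ∞) X] [T2Space X] [SecondCountableTopology X] [ConnectedSpace X], ∀ D ∈ Literature.Geometry.Lorentzian.admissibleVacuumData X, ∃ 𝒟 : Literature.Geometry.Lorentzian.VacuumCauchyDevelopment D, 𝒟.IsMaximal

/-! ### Statements of the registered stubs, under the stub names
The skeleton audit reads the hypotheses of `GenericStationarySettling_of` BY NAME: each head is a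
declared stub. -/
namespace Goal

/-- Statement of `stub_settlesIfCensored`. -/
abbrev stub_settlesIfCensored : Prop := SettlesIfCensored
/-- Statement of `stub_genericCensorshipThirdLaw`. -/
abbrev stub_genericCensorshipThirdLaw : Prop := GenericCensorshipThirdLaw
/-- Statement of `stub_mghdExists`. -/
abbrev stub_mghdExists : Prop := MGHDExists

end Goal

/-! ## §2 Registered stubs (the three `sorry`s of the file), stated EXPANDED over existing declarations
(Statement + Literature prelude only; no vocabulary of this file occurs in a stub signature). -/

/-- **Stub C** (XL, open-problem; the hardest): censored, off-threshold MGHDs of admissible data settle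
to stationary holes with non-degenerate Killing collars — see `SettlesIfCensored`.
[cite: DafermosLuk2017, §1.2.1 (p. 8)] [cite: ChruscielCosta2008, Def. 1.1] -/
theorem stub_settlesIfCensored : ∀ (X : Type) [TopologicalSpace X] [ChartedSpace Literature.Geometry.Lorentzian.E3 X] [IsManifold (𝓡 3) ((⊤ : ℕ∞) : WithTop ℕ∞) X] [T2Space X] [SecondCountableTopology X] [ConnectedSpace X], ∀ D ∈ Literature.Geometry.Lorentzian.admissibleVacuumData X, ∀ 𝒟 : Literature.Geometry.Lorentzian.VacuumCauchyDevelopment D, 𝒟.IsMaximal → Summit.FinalStateConjecture.HasCompleteNullInfinity 𝒟.toCauchyDevelopment → (∀ (O : Set 𝒟.carrier) (d : Literature.Geometry.Lorentzian.FinalStateDecomposition 𝒟.toSpacetime O 0), O = Summit.FinalStateConjecture.exteriorOf 𝒟.toCauchyDevelopment d.charted → Summit.FinalStateConjecture.RaysStayInClosure 𝒟.toCauchyDevelopment O → Summit.FinalStateConjecture.HasExhaustiveCharts d → Summit.FinalStateConjecture.IsFutureOriented d → ∀ i, Literature.Geometry.Lorentzian.Kerr.IsSubextremal (d.mass i) (d.spin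 i)) → ∃ (O : Set 𝒟.carrier) (d : Literature.Geometry.Lorentzian.StationaryFinalStateDecomposition 𝒟.toSpacetime O 2), (∀ i, (∀ [(d.hole i).metric.HasLeviCivita], (d.hole i).IsIPlusRegular ∧ (d.hole i).metric.toPseudoRiemannianMetric.IsRicciFlat ∧ (d.hole i).horizon.Nonempty ∧ (∀ p ∈ (d.hole i).horizon, ∃ (U : Set (d.hole i).carrier) (K : Π x : (d.hole i).carrier, TangentSpace (𝓡 4) x) (κ : ℝ), IsOpen U ∧ connectedComponentIn (d.hole i).horizon p ⊆ U ∧ ContMDiffOn (𝓡 4) ((𝓡 4).prod 𝓘(ℝ, Literature.Geometry.Lorentzian.E4)) ((⊤ : ℕ∞) : WithTop ℕ∞) (fun x ↦ (Bundle.TotalSpace.mk' Literature.Geometry.Lorentzian.E4 x (K x) : TangentBundle (𝓡 4) (d.hole i).carrier)) U ∧ (∀ x ∈ U, ∀ v w : TangentSpace (𝓡 4) x, (d.hole i).metric.val x ((d.hole i).metric.leviCivita K x v) w + (d.hole i).metric.val x v ((d.hole i).metric.leviCivita K x w) = 0) ∧ (∀ x ∈ U, VectorField.mlieBracket (𝓡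 4) (d.hole i).killing K x = 0) ∧ (∀ q ∈ connectedComponentIn (d.hole i).horizon p, K q ≠ 0) ∧ (∀ γ : ℝ → (d.hole i).carrier, IsMIntegralCurve γ K → γ 0 ∈ connectedComponentIn (d.hole i).horizon p → ∀ t, γ t ∈ (d.hole i).horizon) ∧ κ ≠ 0 ∧ ∀ q ∈ connectedComponentIn (d.hole i).horizon p, (d.hole i).metric.leviCivita K q (K q) = κ • K q))) ∧ (∀ i, (∀ x, Function.Injective (mfderiv 𝓘(ℝ, Literature.Geometry.Lorentzian.E4) (𝓡 4) (d.adapted i).toFun x)) ∧ (d.hole i).horizon ⊆ Set.range (d.adapted i).toFun) ∧ O = Summit.FinalStateConjecture.exteriorOf 𝒟.toCauchyDevelopment d.charted ∧ Summit.FinalStateConjecture.RaysStayInClosure 𝒟.toCauchyDevelopment O ∧ (∃ R : Fin d.N → ℝ → ℝ, (∀ i, Filter.Tendsto (R i) Filter.atTop Filter.atTop) ∧ (∀ i, Filter.Tendsto (fun τ ↦ 𝒟.toSpacetime.truncDeviationCk (d.background i) (d.toOver.chart i) 2 (R i τ) τ) Filter.atTop (nhds 0)) ∧ ∀ τ₁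 : ℝ, d.toOver.τ₀ < τ₁ → O \ d.toOver.certifiedLate R τ₁ ⊆ 𝒟.toSpacetime.metric.causalPast 𝒟.toSpacetime.timeOrientation (d.toOver.certifiedSlab R τ₁)) ∧ ((∀ i, Summit.FinalStateConjecture.IsOrthochronous (d.motion i).1) ∧ (∀ i (ρ : ℝ), ∀ᶠ τ in Filter.atTop, ∀ x ∈ (d.background i).truncTimeSlab ρ τ, ∀ v : Literature.Geometry.Lorentzian.E4, mfderiv 𝓘(ℝ, Literature.Geometry.Lorentzian.E4) (𝓡 4) (d.adapted i).toFun ⟨Literature.Geometry.Lorentzian.poincareInv (d.motion i).1 (d.motion i).2 x.1, x.2⟩ v = (d.hole i).timeOrientation.vectorField ((d.adapted i).toFun ⟨Literature.Geometry.Lorentzian.poincareInv (d.motion i).1 (d.motion i).2 x.1, x.2⟩) → 𝒟.toSpacetime.timeOrientation.IsFutureDirected (mfderiv 𝓘(ℝ, Literature.Geometry.Lorentzian.E4) (𝓡 4) (d.toOver.chart i) x (((d.motion i).1 : Literature.Geometry.Lorentzian.E4 ≃L[ℝ] Literature.Geometry.Lorentzian.E4) v))) ∧ ∀ᶠ τ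 in Filter.atTop, ∀ x ∈ (Literature.Geometry.Lorentzian.Minkowski.backgroundOn d.toOver.flatDomain).timeSlab τ, 𝒟.toSpacetime.timeOrientation.IsFutureDirected (mfderiv 𝓘(ℝ, Literature.Geometry.Lorentzian.E4) (𝓡 4) d.toOver.flatChart x (Literature.Geometry.Lorentzian.E4.basisVector 0))) := by
  sorry

/-- **Stub A** (XL, open-problem): generic censorship ⊕ third law (= item stmt-FinalStateConjecture-17297)
— see `GenericCensorshipThirdLaw`. [cite: Christodoulou1999, p. A24] [cite: KehleUnger2025] -/
theorem stub_genericCensorshipThirdLaw : ∀ (X : Type) [TopologicalSpace X] [ChartedSpace Literature.Geometry.Lorentzian.E3 X] [IsManifold (𝓡 3) ((⊤ : ℕ∞) : WithTop ℕ∞) X] [T2Space X] [SecondCountableTopology X] [ConnectedSpace X], Literature.Geometry.Lorentzian.InitialDataSet.IsTameChristodoulouGeneric (Literature.Geometry.Lorentzian.admissibleVacuumData X) (fun D ↦ ∀ 𝒟 : Literature.Geometry.Lorentzian.VacuumCauchyDevelopment D, 𝒟.IsMaximal → Summit.FinalStateConjecture.HasCompleteNullInfinity 𝒟.toCauchyDevelopment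 ∧ ∀ (O : Set 𝒟.carrier) (d : Literature.Geometry.Lorentzian.FinalStateDecomposition 𝒟.toSpacetime O 0), O = Summit.FinalStateConjecture.exteriorOf 𝒟.toCauchyDevelopment d.charted → Summit.FinalStateConjecture.RaysStayInClosure 𝒟.toCauchyDevelopment O → Summit.FinalStateConjecture.HasExhaustiveCharts d → Summit.FinalStateConjecture.IsFutureOriented d → ∀ i, Literature.Geometry.Lorentzian.Kerr.IsSubextremal (d.mass i) (d.spin i)) 1 := by
  sorry

/-- **Stub B** (XL formalisation, known in print): MGHD existence on the admissible class (= item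
stmt-FinalStateConjecture-9937) — see `MGHDExists`. [cite: ChoquetBruhatGeroch1969CMP, Thm. 3 (p. 332)] -/
theorem stub_mghdExists : ∀ (X : Type) [TopologicalSpace X] [ChartedSpace Literature.Geometry.Lorentzian.E3 X] [IsManifold (𝓡 3) ((⊤ : ℕ∞) : WithTop ℕ∞) X] [T2Space X] [SecondCountableTopology X] [ConnectedSpace X], ∀ D ∈ Literature.Geometry.Lorentzian.admissibleVacuumData X, ∃ 𝒟 : Literature.Geometry.Lorentzian.VacuumCauchyDevelopment D, 𝒟.IsMaximal := by
  sorry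

/-! Consistency (elaborated, not kept): each expanded stub statement is, by `δ`-unfolding, the named
proposition the composition consumes. -/
example : Goal.stub_settlesIfCensored := stub_settlesIfCensored
example : Goal.stub_genericCensorshipThirdLaw := stub_genericCensorshipThirdLaw
example : Goal.stub_mghdExists := stub_mghdExists

/-! ## §3 The composition (kernel-checked; no `sorry` of its own) -/

/-- **THE CRUX BY NAME from the three registered stubs.** Tame Christodoulou genericity is monotone in
the property (`IsTameChristodoulouGeneric.mono`, inlined): Stub A's generic property upgrades POINTWISE
on the admissible class to D's — the MGHD conjunct is Stub B, and for a maximal development Stub A's two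
conjuncts (complete `𝓘⁺`; honest `C⁰` Kerr portraits sub-extremal) are exactly Stub C's hypotheses,
whose conclusion is D's settled clause verbatim. [folklore] -/
theorem GenericStationarySettling_of :
    Goal.stub_settlesIfCensored → Goal.stub_genericCensorshipThirdLaw → Goal.stub_mghdExists →
      GenericStationarySettling := by
  intro hS hG hM X _ _ _ _ _ _
  -- tame Christodoulou genericity is monotone in the property (= `IsTameChristodoulouGeneric.mono`)
  have mono : ∀ {P Q : Literature.Geometry.Lorentzian.InitialDataSet (𝓡 3) X → Prop},
      (∀ D ∈ Literature.Geometry.Lorentzian.admissibleVacuumData X, P D → Q D) →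
      Literature.Geometry.Lorentzian.InitialDataSet.IsTameChristodoulouGeneric
        (Literature.Geometry.Lorentzian.admissibleVacuumData X) P 1 →
      Literature.Geometry.Lorentzian.InitialDataSet.IsTameChristodoulouGeneric
        (Literature.Geometry.Lorentzian.admissibleVacuumData X) Q 1 := by
    intro P Q hPQ hP d hd
    obtain ⟨e, F, hF, himm, h0, hinj, hadm, hexc⟩ := hP d ⟨hd.1, fun h ↦ hd.2 (hPQ d hd.1 h)⟩
    exact ⟨e, F, hF, himm, h0, hinj, hadm,
      fun c hc hmem ↦ hexc c hc ⟨hmem.1, fun h ↦ hmem.2 (hPQ _ hmem.1 h)⟩⟩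
  refine mono ?_ (hG X)
  intro D hD hP
  refine ⟨hM X D hD, fun 𝒟 h𝒟 ↦ ?_⟩
  obtain ⟨hscri, hthird⟩ := hP 𝒟 h𝒟
  exact ⟨hscri, hS X D hD 𝒟 h𝒟 hscri hthird⟩

/-- **The crux from the skeleton** (closed modulo the three `sorry`s). [folklore] -/
theorem GenericStationarySettling_proof : GenericStationarySettling :=
  GenericStationarySettling_of stub_settlesIfCensored stub_genericCensorshipThirdLaw stub_mghdExists

/-! ## §4 Sanity (no `sorry`): D implies generic weak cosmic censorship — Stub A's first conjunct is a
NECESSARY part of the generic half (monotonicity again); its third-law conjunct and Stub C are the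
genuine factors. -/

/-- **The crux implies generic completeness of `𝓘⁺`** (forget the settled clause). [folklore] -/
theorem genericCensorship_of_crux (h : GenericStationarySettling) :
    ∀ (X : Type) [TopologicalSpace X] [ChartedSpace Literature.Geometry.Lorentzian.E3 X]
      [IsManifold (𝓡 3) ((⊤ : ℕ∞) : WithTop ℕ∞) X] [T2Space X] [SecondCountableTopology X]
      [ConnectedSpace X],
      Literature.Geometry.Lorentzian.InitialDataSet.IsTameChristodoulouGeneric
        (Literature.Geometry.Lorentzian.admissibleVacuumData X)
        (fun D ↦ ∀ 𝒟 : Literature.Geometry.Lorentzian.VacuumCauchyDevelopment D, 𝒟.IsMaximal →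
          Summit.FinalStateConjecture.HasCompleteNullInfinity 𝒟.toCauchyDevelopment) 1 := by
  intro X _ _ _ _ _ _ d hd
  obtain ⟨e, F, hF, himm, h0, hinj, hadm, hexc⟩ :=
    h X d ⟨hd.1, fun hP ↦ hd.2 fun 𝒟 h𝒟 ↦ (hP.2 𝒟 h𝒟).1⟩
  exact ⟨e, F, hF, himm, h0, hinj, hadm,
    fun c hc hmem ↦ hexc c hc ⟨hmem.1, fun hP ↦ hmem.2 fun 𝒟 h𝒟 ↦ (hP.2 𝒟 h𝒟).1⟩⟩

end Summit.FinalStateConjecture.FinalStateConjecture.Cruxes.GenericStationarySettling.Birth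

end
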